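import Summits.QuantumFields.BalabanUV.Beta.AveragingPointsOfView
import Literature.MathematicalPhysics.QuantumFieldTheory.Balaban1983to89.Beta.ResolventComposition

/-!
# K-U3b — the m-fold COMPOSITE rooted linear average differs from the straight block-`L^m` contour sum by a COARSE-EXACT form,
# with an explicit, recursively computed potential (β sub-cell, row D1 of BINDER-OWNERS; statement drafted by the letter supplier
# an3 (gen 37) at the row owner's request R-D1-g24-2 (A); owner an2 files)

HONEST FRAMING (cell charter, verbatim): «discharging BetaPertH makes Balaban's UV stability UNCONDITIONAL — a real
constructive-QFT result; it is NOT the continuum limit and NOT the Clay problem.»  DERIVED cell leaf over the cell's OWN typed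
objects, BY NAME: the lead's `AffineAveraging.contourSum ∕ dz ∕ blockSum` (straight block-contour sum, coarse exterior derivative,
block sum), an1's ROOTED linear average `AveragingContoursRooted.linAvgAt` and rooted tree gauge `treeGaugeAt`, an1's one-level
defect identity `AveragingPointsOfView.contourSum_sub_linAvgAt` («the two averagings of a raw field differ by the coarse exact form
`dz (blockSum N λ^ρ_A)`») and the lead's semigroup law `ResolventComposition.contourSum_mul` (`𝒬_{ML} = 𝒬_L ∘ 𝒬_M`).  No statement of
Bałaban's papers is typed here, no `[cite:]` tag, no `Prop` fact, no binder of the β-function wall is instantiated.  NOT `BetaPertH`;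
NOT continuum; NOT Clay.  HONEST DEPENDENCY (verbatim): «continuum YM on T⁴ ⇐ BetaPertH ∧ nine spine estimates (0/9 proved);
BetaPertH ⇐ (D1) ∧ (D4) ∧ CAP+tail; G-an2-4 gates asym, D1 and NE2/3/4.»

WHAT THIS FILE IS FOR (row D1, clause (S) ∕ the composite comparison family `JcComp`, dressing of record (a1*)_m, R-D1-g24-2):
the linearisation at the trivial configuration of the m-fold ITERATE of Bałaban's rooted block-`L` averaging is the m-fold composite
`linAvgAt ρ_{m−1} (⋯ (linAvgAt ρ₀ A L) ⋯) L` of an1's rooted LINEAR averages (each level read on `ℤ^d` again, as everywhere in this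
cell), while the straight one-shot literal's constraint row at block side `L^m` is `contourSum (L^m)`.  K-U3b says the two differ by
`dz` of an explicit coarse 0-form (COARSE-EXACTNESS), for every `m`, every dimension, every sequence of root offsets, every field:

* §1 TRANSPORT LEMMA `contourSum_sub_linAvgAt_of_sub_eq_dz` («coarse-exact in ⟹ coarser-exact out»): if `C − B = dz g` then
  `contourSum L C − linAvgAt ρ B L = dz (blockSum L (g + treeGaugeAt ρ B L))` — one-level defect identity + `contourSum_dz`.
* §2 THE CASE m = 2 `contourSum_mul_sub_linAvgAt_linAvgAt` (the instance the engine object (a1*) and K-U3a use at `(Lc, m) = (3, 2)`):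
  `contourSum (M·L) A − linAvgAt ρ' (linAvgAt ρ A M) L = dz (blockSum L (blockSum M (treeGaugeAt ρ A M) + treeGaugeAt ρ' (linAvgAt ρ A M) L))`.
* §3 ALL m: [our object] `compLinAvgAt r L m` (the m-fold composite, root offset `r k` at level `k`) and [our object] `compDefectAt r L m`
  (its coarse potential, `ζ₀ = 0`, `ζ_{m+1} = blockSum L (ζ_m + treeGaugeAt ρ_m (compLinAvgAt r L m A) L)`), and the theorem
  `contourSum_pow_sub_compLinAvgAt`: `contourSum (L^m) A − compLinAvgAt r L m A = dz (compDefectAt r L m A)` (induction on `m` by §1 and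
  `contourSum_mul`).
* §4 COROLLARIES read by the row: the defect is BLIND TO COARSE-CLOSEDNESS TESTS (`curv` of it vanishes: `curv_dz`), and the two
  constraint rows AGREE on every field whose rooted tree gauges vanish at every level (in particular the potential of a comb-axial
  tower is `0`).
* §5 (optional, «K-U3c») PURE-GAUGE INPUTS: [our object] `compRootPullback r L m` and `compLinAvgAt_dz`:
  `compLinAvgAt r L m (dz f) = dz (compRootPullback r L m f)` (an1's `linAvgAt_grad` iterated), whence `dz_compDefectAt_dz`:
  `dz (compDefectAt r L m (dz f)) = dz (blockSum (L^m) f − compRootPullback r L m f)`.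

What this file does NOT do: it does not type the corrector `Ψ_m = 1 − grad ∘ Ext ∘ ζ_m` nor the congruence of relative inverses
(K-U3a, owner, matrix level), asserts nothing about the NON-linear averages beyond their linearisation BY NAME (an1's `linAvgAt` is the
cell's typed first jet of the rooted average), and instantiates no binder.  Straightforward finite-difference algebra [folklore] over the
named cell objects; the two recursive definitions are ABBREVIATIONS of iterated cell objects ([our object], no mathematical content).
COURIER NOTE (row-D1 owner an2 gen 24): filed for the author an3-g37 (planner seat) under the module name `…CoarseExactLevels` (the owner's LamAt-form
K-U3b `CompositeAveragingCoarseExact` p240084 shares the namespace, distinct declarations); bytes = an3's draft v1.1 sha16 ac11fc26f6a565cd + six one-line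
docstrings on the `rfl` clauses (gate lint), nothing else changed.
-/

namespace Summit.QuantumFields.BalabanUV.Beta.CompositeAveragingCoarseExact

open Finset
open scoped BigOperators
open Literature.MathematicalPhysics.QuantumFieldTheory
open Literature.MathematicalPhysics.QuantumFieldTheory.Balaban1983to89
open Literature.MathematicalPhysics.QuantumFieldTheory.Balaban1983to89.Beta
open AffineAveraging (Site Form0 Form1 box toSite unitVec dz curv blockSum contourSum contourSum_dz curv_dz)
open AveragingContoursRooted (linAvgAt treeGaugeAt)
open ResolventComposition (contourSum_mul contourSum_one)
open Summit.QuantumFields.BalabanUV.Beta.AveragingPointsOfView (contourSum_sub_linAvgAt)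

noncomputable section

variable {n : ℕ}

/-! ## §1 The transport lemma: coarse-exact in ⟹ coarser-exact out -/

/-- [folklore] Additivity of the straight contour sum against a coarse-exact summand, pointwise:
`contourSum L (B + dz g) = contourSum L B + dz (blockSum L g)` (`contourSum_dz`). -/
theorem contourSum_add_dz_apply (L : ℕ) (B : Form1 n ℝ) (g : Form0 n ℝ) (μ : Fin n) (Y : Site n) :
    contourSum L (B + dz g) μ Y = contourSum L B μ Y + dz (blockSum L g) μ Y := by
  rw [← contourSum_dz L g]
  simp only [contourSum, Pi.add_apply, Finset.sum_add_distrib]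

/-- [folklore] **TRANSPORT LEMMA («coarse-exact in ⟹ coarser-exact out»).**  If a 1-form `C` differs from `B` by the exact form
`dz g`, then the straight block-`L` contour sum of `C` differs from an1's ROOTED linear average of `B` (root offset `r`) by the
COARSE exact form `dz (blockSum L (g + treeGaugeAt ρ B L))`: the level's own rooted tree gauge of `B` is added to the inherited
potential and the sum is block-summed (`AveragingPointsOfView.contourSum_sub_linAvgAt` + `contourSum_dz`). -/
theorem contourSum_sub_linAvgAt_of_sub_eq_dz {L : ℕ} (r : Fin n → ℕ) (B C : Form1 n ℝ) (g : Form0 n ℝ)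
    (h : ∀ μ y, C μ y - B μ y = dz g μ y) (μ : Fin n) (Y : Site n) :
    contourSum L C μ Y - linAvgAt (toSite r) B L μ Y
      = dz (blockSum L (g + treeGaugeAt (toSite r) B L)) μ Y := by
  have hC : C = B + dz g := by
    funext μ' y'
    have := h μ' y'
    simp only [Pi.add_apply]
    linarith
  have h1 := contourSum_sub_linAvgAt (N := L) r B μ Y
  rw [hC, contourSum_add_dz_apply]
  simp only [dz, blockSum, Pi.add_apply, Finset.sum_add_distrib] at h1 ⊢
  linarith

/-! ## §2 The case `m = 2` (two levels, block sides `M` then `L`, root offsets `r` then `r'`) -/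

/-- [folklore] **K-U3b AT m = 2.**  The straight block-`M·L` contour sum and the COMPOSITE of two rooted linear averages (inner: block
`M`, root offset `r`; outer: block `L`, root offset `r'`, applied to the inner average read as a 1-form on `ℤ^d`) differ by the coarse
exact form with the EXPLICIT potential `blockSum L (blockSum M (treeGaugeAt ρ A M) + treeGaugeAt ρ' (linAvgAt ρ A M) L)`.
Row D1 reads it at `M = L = Lc`, `r = r' = ctr`: the composite first jet `dΦ^comp_2(𝟙)` minus the one-shot row `contourSum (Lc^2)`
is coarse-exact — the input of the corrector `Ψ_2` of the dressing of record (a1*) (R-D1-g24-2). -/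
theorem contourSum_mul_sub_linAvgAt_linAvgAt {M L : ℕ} (hM : 0 < M) (r r' : Fin n → ℕ) (A : Form1 n ℝ)
    (μ : Fin n) (Y : Site n) :
    contourSum (M * L) A μ Y - linAvgAt (toSite r') (linAvgAt (toSite r) A M) L μ Y
      = dz (blockSum L (blockSum M (treeGaugeAt (toSite r) A M)
            + treeGaugeAt (toSite r') (linAvgAt (toSite r) A M) L)) μ Y := by
  rw [contourSum_mul M L hM A]
  exact contourSum_sub_linAvgAt_of_sub_eq_dz r' (linAvgAt (toSite r) A M) (contourSum M A)
    (blockSum M (treeGaugeAt (toSite r) A M)) (fun μ' y' => contourSum_sub_linAvgAt r A μ' y') μ Y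

/-! ## §3 All `m`: the composite average, its coarse potential, and the induction -/

/-- [our object] The `m`-fold COMPOSITE rooted linear average at common block side `L`, root offset `r k` at level `k`
(level `k+1` = an1's `linAvgAt (toSite (r k)) (level k) L`, read on `ℤ^d` again; `m = 0` is the identity). -/
def compLinAvgAt (r : ℕ → (Fin n → ℕ)) (L : ℕ) : ℕ → Form1 n ℝ → Form1 n ℝ
  | 0, A => A
  | m + 1, A => linAvgAt (toSite (r m)) (compLinAvgAt r L m A) L

/-- [our object] The COARSE POTENTIAL of the composite's defect: `ζ₀ = 0`,
`ζ_{m+1} = blockSum L (ζ_m + treeGaugeAt ρ_m (compLinAvgAt r L m A) L)`. -/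
def compDefectAt (r : ℕ → (Fin n → ℕ)) (L : ℕ) : ℕ → Form1 n ℝ → Form0 n ℝ
  | 0, _ => 0
  | m + 1, A => blockSum L (compDefectAt r L m A + treeGaugeAt (toSite (r m)) (compLinAvgAt r L m A) L)

/-- [folklore] `m = 0`: the identity. -/
@[simp] theorem compLinAvgAt_zero (r : ℕ → (Fin n → ℕ)) (L : ℕ) (A : Form1 n ℝ) : compLinAvgAt r L 0 A = A := rfl

/-- [folklore] The successor clause of `compLinAvgAt`. -/
theorem compLinAvgAt_succ (r : ℕ → (Fin n → ℕ)) (L m : ℕ) (A : Form1 n ℝ) :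
    compLinAvgAt r L (m + 1) A = linAvgAt (toSite (r m)) (compLinAvgAt r L m A) L := rfl

/-- [folklore] `m = 0`: zero potential. -/
@[simp] theorem compDefectAt_zero (r : ℕ → (Fin n → ℕ)) (L : ℕ) (A : Form1 n ℝ) : compDefectAt r L 0 A = 0 := rfl

/-- [folklore] The successor clause of `compDefectAt`. -/
theorem compDefectAt_succ (r : ℕ → (Fin n → ℕ)) (L m : ℕ) (A : Form1 n ℝ) :
    compDefectAt r L (m + 1) A
      = blockSum L (compDefectAt r L m A + treeGaugeAt (toSite (r m)) (compLinAvgAt r L m A) L) := rfl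

/-- The one-level composite is an1's rooted linear average itself. -/
theorem compLinAvgAt_one (r : ℕ → (Fin n → ℕ)) (L : ℕ) (A : Form1 n ℝ) :
    compLinAvgAt r L 1 A = linAvgAt (toSite (r 0)) A L := rfl

/-- The two-level composite is the object of §2. -/
theorem compLinAvgAt_two (r : ℕ → (Fin n → ℕ)) (L : ℕ) (A : Form1 n ℝ) :
    compLinAvgAt r L 2 A = linAvgAt (toSite (r 1)) (linAvgAt (toSite (r 0)) A L) L := rfl

/-- [folklore] **K-U3b, ALL m — COARSE-EXACTNESS OF THE COMPOSITE'S DEFECT WITH ITS EXPLICIT POTENTIAL.**  For `0 < L`, every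
sequence of root offsets, every `m`, every field: `contourSum (L^m) A − compLinAvgAt r L m A = dz (compDefectAt r L m A)`
(induction on `m`: `contourSum_one`; `contourSum_mul` + the transport lemma of §1). -/
theorem contourSum_pow_sub_compLinAvgAt {L : ℕ} (hL : 0 < L) (r : ℕ → (Fin n → ℕ)) (A : Form1 n ℝ) :
    ∀ (m : ℕ) (μ : Fin n) (Y : Site n),
      contourSum (L ^ m) A μ Y - compLinAvgAt r L m A μ Y = dz (compDefectAt r L m A) μ Y
  | 0, μ, Y => by
      simp [compLinAvgAt, compDefectAt, contourSum_one, dz]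
  | m + 1, μ, Y => by
      rw [pow_succ, contourSum_mul (L ^ m) L (pow_pos hL m) A, compLinAvgAt_succ, compDefectAt_succ]
      exact contourSum_sub_linAvgAt_of_sub_eq_dz (r m) (compLinAvgAt r L m A) (contourSum (L ^ m) A)
        (compDefectAt r L m A) (fun μ' y' => contourSum_pow_sub_compLinAvgAt hL r A m μ' y') μ Y

/-- The same, as an identity of 1-forms. -/
theorem contourSum_pow_eq_compLinAvgAt_add_dz {L : ℕ} (hL : 0 < L) (r : ℕ → (Fin n → ℕ)) (A : Form1 n ℝ) (m : ℕ) :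
    contourSum (L ^ m) A = compLinAvgAt r L m A + dz (compDefectAt r L m A) := by
  funext μ Y
  have := contourSum_pow_sub_compLinAvgAt hL r A m μ Y
  simp only [Pi.add_apply]
  linarith

/-! ## §4 Corollaries read by the row -/

/-- [folklore] The defect is CURVATURE-FREE on the coarse lattice (it is `dz` of something; `AffineAveraging.curv_dz`): every
test of the two constraint rows against coarse-closed data agrees. -/
theorem curv_contourSum_pow_sub_compLinAvgAt {L : ℕ} (hL : 0 < L) (r : ℕ → (Fin n → ℕ)) (A : Form1 n ℝ) (m : ℕ) :
    curv (contourSum (L ^ m) A - compLinAvgAt r L m A) = 0 := by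
  have h : contourSum (L ^ m) A - compLinAvgAt r L m A = dz (compDefectAt r L m A) := by
    rw [contourSum_pow_eq_compLinAvgAt_add_dz hL r A m]
    abel
  rw [h, curv_dz]

/-- [folklore] If the potential vanishes the two rows coincide (e.g. a field all of whose iterated rooted tree gauges vanish —
a comb-axial tower — by `compDefectAt_succ`). -/
theorem contourSum_pow_eq_compLinAvgAt_of_compDefectAt_eq_zero {L : ℕ} (hL : 0 < L) (r : ℕ → (Fin n → ℕ))
    (A : Form1 n ℝ) (m : ℕ) (h0 : compDefectAt r L m A = 0) :
    contourSum (L ^ m) A = compLinAvgAt r L m A := by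
  rw [contourSum_pow_eq_compLinAvgAt_add_dz hL r A m, h0]
  funext μ Y
  simp [dz]

/-! ## §5 (optional, «K-U3c») Pure-gauge inputs: the composite of an exact form is coarse-exact with the rooted pull-back as
potential, hence the defect's potential on `dz f` is `blockSum (L^m) f − (rooted pull-back)` up to `dz`-closed terms

These are the identities behind «`Ψ_m` maps the straight gauge directions `N_n` onto the ROOTED ones» (an3 memo A2-ENGINE-TERMS v1.1
§7 (B)): an1's `linAvgAt_grad` iterated. -/

/-- [our object] The `m`-fold ROOTED PULL-BACK of a 0-form (level `k+1`: `y ↦ |box|·F_k (L•y + ρ_k)`, the count factor `|box| = L^d`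
being an1's normalisation of `linAvgAt`; `m = 0` is the identity). -/
def compRootPullback (r : ℕ → (Fin n → ℕ)) (L : ℕ) : ℕ → Form0 n ℝ → Form0 n ℝ
  | 0, f => f
  | m + 1, f => fun y => ((box n L).card : ℝ) * compRootPullback r L m f ((L : ℤ) • y + toSite (r m))

/-- [folklore] `m = 0`: the identity. -/
@[simp] theorem compRootPullback_zero (r : ℕ → (Fin n → ℕ)) (L : ℕ) (f : Form0 n ℝ) : compRootPullback r L 0 f = f := rfl

/-- [folklore] The successor clause of `compRootPullback`. -/
theorem compRootPullback_succ (r : ℕ → (Fin n → ℕ)) (L m : ℕ) (f : Form0 n ℝ) :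
    compRootPullback r L (m + 1) f
      = fun y => ((box n L).card : ℝ) * compRootPullback r L m f ((L : ℤ) • y + toSite (r m)) := rfl

/-- [folklore] One level (an1's `AveragingContoursRooted.linAvgAt_grad`, re-read as a coarse exterior derivative): the rooted linear
average of an exact form is the coarse exact form of the rooted pull-back, `linAvgAt ρ (dz F) L = dz (y ↦ |box|·F (L•y + ρ))`. -/
theorem linAvgAt_dz_eq_dz_pullback (r : Fin n → ℕ) (F : Form0 n ℝ) (L : ℕ) (μ : Fin n) (y : Site n) :
    linAvgAt (toSite r) (dz F) L μ y
      = dz (fun y' : Site n => ((box n L).card : ℝ) * F ((L : ℤ) • y' + toSite r)) μ y := by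
  have h : linAvgAt (toSite r) (dz F) L μ y
      = (box n L).card • (F ((L : ℤ) • y + toSite r + (L : ℤ) • unitVec μ) - F ((L : ℤ) • y + toSite r)) :=
    AveragingContoursRooted.linAvgAt_grad (toSite r) F L μ y
  rw [h, nsmul_eq_mul]
  simp only [dz, smul_add]
  rw [add_right_comm ((L : ℤ) • y) ((L : ℤ) • unitVec μ) (toSite r)]
  ring

/-- [folklore] **K-U3c.**  The `m`-fold composite rooted linear average of an exact form is the coarse exact form of the `m`-fold
rooted pull-back: `compLinAvgAt r L m (dz f) = dz (compRootPullback r L m f)`. -/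
theorem compLinAvgAt_dz (r : ℕ → (Fin n → ℕ)) (L : ℕ) (f : Form0 n ℝ) :
    ∀ m : ℕ, compLinAvgAt r L m (dz f) = dz (compRootPullback r L m f)
  | 0 => rfl
  | m + 1 => by
      rw [compLinAvgAt_succ, compLinAvgAt_dz r L f m, compRootPullback_succ]
      funext μ y
      exact linAvgAt_dz_eq_dz_pullback (r m) (compRootPullback r L m f) L μ y

/-- [folklore] Consequently, ON EXACT INPUTS the defect's potential is `blockSum (L^m) f − compRootPullback r L m f` up to a `dz`-closed
0-form: `dz (compDefectAt r L m (dz f)) = dz (blockSum (L^m) f − compRootPullback r L m f)` (`contourSum_dz` + K-U3b + K-U3c) — the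
corrector `1 − grad ∘ Ext ∘ ζ_m` therefore maps the straight coarse gauge direction `dz (blockSum (L^m) f)`-data onto the rooted one. -/
theorem dz_compDefectAt_dz {L : ℕ} (hL : 0 < L) (r : ℕ → (Fin n → ℕ)) (f : Form0 n ℝ) (m : ℕ) :
    dz (compDefectAt r L m (dz f)) = dz (blockSum (L ^ m) f - compRootPullback r L m f) := by
  have h1 := contourSum_pow_eq_compLinAvgAt_add_dz hL r (dz f) m
  rw [contourSum_dz, compLinAvgAt_dz] at h1
  funext μ y
  have h2 := congrArg (fun (B : Form1 n ℝ) => B μ y) h1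
  simp only [Pi.add_apply, dz, Pi.sub_apply] at h2 ⊢
  linarith

end

end Summit.QuantumFields.BalabanUV.Beta.CompositeAveragingCoarseExact
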